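import Mathlib.Analysis.Calculus.ParametricIntegral
import Mathlib.Analysis.Complex.CauchyIntegral
import Mathlib.Analysis.SpecialFunctions.Trigonometric.DerivHyp
import Mathlib.MeasureTheory.Group.Integral
import Literature.Probability.LatticeModels.PhasesLowerCorrelations
import HarnessLib

/-!
# The McBryan–Spencer complex-rotation bound in Ginibre's general framework: abelian models with
# complex many-body couplings, `|∫ χ₀ e^{∑ Re(Kₐχₐ)} dμ| ≤ e^{-q₀} exp(∑ₐ ‖Kₐ‖(cosh qₐ − 1)) ∫ e^{∑ Re(Kₐχₐ)} dμ`

Topic `Literature/Probability/LatticeModels`. O. A. McBryan, T. Spencer, *On the decay of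
correlations in SO(n)-symmetric ferromagnets*, Comm. Math. Phys. **53** (1977) 299–302
[McBryanSpencer1977], proof of the main theorem: the **complex rotation** `θ_j ↦ θ_j + i a_j` of the
angle variables of the plane rotator (S. Friedli, Y. Velenik, *Statistical Mechanics of Lattice
Systems*, CUP 2017, Thm. 9.12 and display (9.23) [FriedliVelenik2017]). The same device for `U(1)`
LATTICE GAUGE FIELDS — rotating the edge angles, the plaquette angles `θ_p = (dθ)_p` rotate by
`i (da)_p` — is the engine of J. Glimm, A. Jaffe, *Quark trapping for lattice `U(1)` gauge fields*,
Phys. Lett. **66B** (1977) 67–69 [GlimmJaffe1977QuarkTrapping] (logarithmic confinement of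
three-dimensional `U(1)` lattice gauge theory).

The tree proves the bound for the nearest-neighbour plane rotator with a uniform coupling
(`BondSystem.abs_expect_cosDiff_le_exp_cosh`, `PlaneRotatorComplexRotationBound.lean`). This file
PROVES it in the generality of the tree's Ginibre toolkit (`GinibreModel`, `PhasesLowerCorrelations`):
`Ω` a compact abelian topological group with a finite right-invariant Borel measure `μ` (Haar
measure of a torus `U(1)^S` in the applications), finitely many continuous unitary characters
`χₐ : Ω → U(1)` (MANY-BODY terms allowed: plaquette holonomies of a `U(1)` gauge field, or the
`U(1)`-part of a `U(N)` gauge field) with COMPLEX couplings `Kₐ ∈ ℂ` (weight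
`exp(∑ₐ Re(Kₐ χₐ(θ)))` = `complexGinibreWeight`; for `Kₐ = Jₐ uₐ`, `Jₐ ≥ 0`, `uₐ ∈ U(1)` this is the
phased weight `phasedGinibreWeight χ J u` of `PhasesLowerCorrelations.lean`,
`phasedGinibreWeight_eq_complexGinibreWeight`), an observed character `χ₀`, and a ROTATION: a map
`γ : ℝ → Ω` along which every character is an exponential, `χₐ(γ τ) = e^{iτqₐ}`, `χ₀(γ τ) = e^{iτq₀}`
(for the torus, `γ τ = (e^{iτ aₛ})ₛ = expField a τ` and `q = ⟨a, m⟩` for the monomial character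
`∏ θₛ^{mₛ}`; `coordChar_expField`, `monomialChar_expField`). Then
(`norm_integral_char_mul_complexGinibreWeight_le`)

  `‖∫ χ₀(θ) e^{∑ₐ Re(Kₐχₐ(θ))} dμ‖ ≤ e^{−q₀} · exp(∑ₐ ‖Kₐ‖ (cosh qₐ − 1)) · ∫ e^{∑ₐ Re(Kₐχₐ(θ))} dμ`,   (★)

and consequently, for every `c ∈ ℂ` (`abs_integral_reMulChar_mul_complexGinibreWeight_le`,
`abs_complexGinibreExpect_reMulChar_le`),

  `|⟨Re(c χ₀)⟩_K| ≤ ‖c‖ · e^{−q₀} · exp(∑ₐ ‖Kₐ‖ (cosh qₐ − 1))`.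

## The proof (the tree's route of `PlaneRotatorComplexRotationBound.lean`, verbatim in the general framework)

Rotate by the COMPLEX parameter `ζ`: `Φ(ζ) = ∫ χ₀(θ) e^{iζq₀} exp(½ ∑ₐ (Kₐχₐ(θ) e^{iζqₐ} +
conj(Kₐχₐ(θ)) e^{−iζqₐ})) dμ`. For real `ζ = τ` the integrand is the un-rotated one (`ζ = 0`)
evaluated at `θ · γ(τ)`, so `Φ(τ) = Φ(0)` by right-invariance of `μ` (`charRotationFn_ofReal`); `Φ`
is entire (differentiation under the integral sign over the compact `Ω`); by the identity theorem
`Φ(i) = Φ(0)` (`charRotationFn_I`); at `ζ = i` the modulus of the integrand is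
`e^{−q₀} exp(∑ₐ Re(Kₐχₐ) cosh qₐ) ≤ e^{−q₀} exp(∑ₐ ‖Kₐ‖(cosh qₐ − 1)) exp(∑ₐ Re(Kₐχₐ))`
(`norm_charRotationIntegrand_I_le`), while `Φ(0) = ∫ χ₀ e^{∑ Re(Kₐχₐ)} dμ`.

Everything is PROVED; no named fact is introduced. Not here: the optimisation of the rotation
(`q` a lattice Green's function), infinite volume.

## References

* O. A. McBryan, T. Spencer, Comm. Math. Phys. 53 (1977) 299–302, proof of the main theorem.
  [McBryanSpencer1977]
* S. Friedli, Y. Velenik, *Statistical Mechanics of Lattice Systems*, CUP 2017, §9.4, Thm. 9.12,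
  display (9.23). [FriedliVelenik2017]
* J. Glimm, A. Jaffe, Phys. Lett. 66B (1977) 67–69 (the gauge-field version). [GlimmJaffe1977QuarkTrapping]
* J. Ginibre, Comm. Math. Phys. 16 (1970) 310–328 (the framework: characters of a compact abelian
  group). [Ginibre1970]

Mathlib: `hasDerivAt_integral_of_dominated_loc_of_deriv_le`, `DifferentiableOn.analyticOnNhd`,
`AnalyticOnNhd.eq_of_frequently_eq`, `integral_mul_right_eq_self`.
-/

noncomputable section

open MeasureTheory Finset Filter Complex
open scoped BigOperators ComplexConjugate Topology

namespace Literature.Probability.LatticeModels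

/-! ### The abelian model with complex couplings -/

section Model

variable {Ω : Type*} [CommGroup Ω] [TopologicalSpace Ω] {ι : Type*} [Fintype ι]

/-- The (negative) Hamiltonian with complex couplings `∑ₐ Re(Kₐ χₐ(θ))`; for `Kₐ = Jₐ uₐ` with
`Jₐ ≥ 0`, `|uₐ| = 1` this is the phased Hamiltonian `∑ₐ Jₐ Re(uₐ χₐ(θ))` (for the `U(1)`-part of a
`U(N)` lattice gauge field conditioned on the non-abelian part, `K_p = β tr U_p`).
[cite: McBryanSpencer1977, proof of the main theorem] -/
def complexHamiltonian (χ : ι → Ω →ₜ* Circle) (K : ι → ℂ) (θ : Ω) : ℝ :=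
  ∑ a, (K a * ((χ a θ : Circle) : ℂ)).re

/-- The Gibbs weight `exp(∑ₐ Re(Kₐ χₐ(θ)))` with complex couplings.
[cite: McBryanSpencer1977, proof of the main theorem] -/
def complexGinibreWeight (χ : ι → Ω →ₜ* Circle) (K : ι → ℂ) (θ : Ω) : ℝ :=
  Real.exp (complexHamiltonian χ K θ)

/-- The Gibbs expectation `⟨F⟩_K = ∫ F e^{∑ Re(Kₐχₐ)} dμ / ∫ e^{∑ Re(Kₐχₐ)} dμ`.
[cite: McBryanSpencer1977, proof of the main theorem] -/
def complexGinibreExpect [MeasurableSpace Ω] (μ : Measure Ω) (χ : ι → Ω →ₜ* Circle) (K : ι → ℂ)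
    (F : Ω → ℝ) : ℝ :=
  (∫ θ, F θ * complexGinibreWeight χ K θ ∂μ) / ∫ θ, complexGinibreWeight χ K θ ∂μ

/-- The weight is positive. [cite: McBryanSpencer1977, proof of the main theorem (set-up)] -/
theorem complexGinibreWeight_pos (χ : ι → Ω →ₜ* Circle) (K : ι → ℂ) (θ : Ω) :
    0 < complexGinibreWeight χ K θ :=
  Real.exp_pos _

/-- A character value, read in `ℂ`, is a continuous function of the configuration. [cite: Ginibre1970, main theorem (continuous unitary characters)] -/
theorem continuous_coe_char (χ : Ω →ₜ* Circle) : Continuous fun θ : Ω => ((χ θ : Circle) : ℂ) :=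
  continuous_subtype_val.comp (map_continuous χ)

/-- The Hamiltonian is continuous. [cite: McBryanSpencer1977, proof of the main theorem (set-up)] -/
theorem continuous_complexHamiltonian (χ : ι → Ω →ₜ* Circle) (K : ι → ℂ) :
    Continuous (complexHamiltonian χ K) := by
  unfold complexHamiltonian
  exact continuous_finsetSum _ fun a _ =>
    Complex.continuous_re.comp (continuous_const.mul (continuous_coe_char (χ a)))

/-- The weight is continuous. [cite: McBryanSpencer1977, proof of the main theorem (set-up)] -/
theorem continuous_complexGinibreWeight (χ : ι → Ω →ₜ* Circle) (K : ι → ℂ) :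
    Continuous (complexGinibreWeight χ K) :=
  Real.continuous_exp.comp (continuous_complexHamiltonian χ K)

/-- A term of the Hamiltonian is at most the modulus of its coupling: `Re(K χ(θ)) ≤ ‖K‖`.
[cite: FriedliVelenik2017, Thm 9.12, display (9.23) (the step cos ≤ 1)] -/
theorem re_coupling_mul_char_le (K : ℂ) (χ : Ω →ₜ* Circle) (θ : Ω) :
    (K * ((χ θ : Circle) : ℂ)).re ≤ ‖K‖ := by
  refine (Complex.re_le_norm _).trans_eq ?_
  rw [norm_mul, Circle.norm_coe, mul_one]

/-- `|Re(K χ(θ))| ≤ ‖K‖`. [cite: FriedliVelenik2017, Thm 9.12, display (9.23) (the step cos ≤ 1)] -/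
theorem abs_re_coupling_mul_char_le (K : ℂ) (χ : Ω →ₜ* Circle) (θ : Ω) :
    |(K * ((χ θ : Circle) : ℂ)).re| ≤ ‖K‖ := by
  refine (Complex.abs_re_le_norm _).trans_eq ?_
  rw [norm_mul, Circle.norm_coe, mul_one]

/-- The weight is at least `exp(−∑ₐ ‖Kₐ‖)`. [cite: McBryanSpencer1977, proof of the main theorem (set-up)] -/
theorem exp_neg_sum_norm_le_complexGinibreWeight (χ : ι → Ω →ₜ* Circle) (K : ι → ℂ) (θ : Ω) :
    Real.exp (-∑ a, ‖K a‖) ≤ complexGinibreWeight χ K θ := by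
  unfold complexGinibreWeight complexHamiltonian
  rw [Real.exp_le_exp, ← Finset.sum_neg_distrib]
  exact Finset.sum_le_sum fun a _ => neg_le_of_abs_le (abs_re_coupling_mul_char_le (K a) (χ a) θ)

/-- The phased weight of `PhasesLowerCorrelations.lean` (`Jₐ ≥ 0` real, phases `uₐ`) is the
complex-coupling weight with `Kₐ = Jₐ uₐ`. [cite: MessagerMiracleSolePfister1978, Prop. 1 (phased couplings as complex couplings)] -/
theorem phasedGinibreWeight_eq_complexGinibreWeight (χ : ι → Ω →ₜ* Circle) (J : ι → ℝ)
    (u : ι → Circle) :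
    phasedGinibreWeight χ J u = complexGinibreWeight χ (fun a => (J a : ℂ) * ((u a : Circle) : ℂ)) := by
  funext θ
  simp only [phasedGinibreWeight, phasedHamiltonian, complexGinibreWeight, complexHamiltonian,
    rePhased, mul_assoc, Complex.re_ofReal_mul]

/-- Correspondingly for the expectations. [cite: MessagerMiracleSolePfister1978, Prop. 1 (phased couplings as complex couplings)] -/
theorem phasedGinibreExpect_eq_complexGinibreExpect [MeasurableSpace Ω] (μ : Measure Ω)
    (χ : ι → Ω →ₜ* Circle) (J : ι → ℝ) (u : ι → Circle) (F : Ω → ℝ) :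
    phasedGinibreExpect μ χ J u F =
      complexGinibreExpect μ χ (fun a => (J a : ℂ) * ((u a : Circle) : ℂ)) F := by
  simp only [phasedGinibreExpect, complexGinibreExpect, phasedGinibreWeight_eq_complexGinibreWeight]

end Model

/-! ### The complex-rotated integrand -/

section Integrand

variable {Ω : Type*} [CommGroup Ω] [TopologicalSpace Ω] {ι : Type*} [Fintype ι]
  (χ : ι → Ω →ₜ* Circle) (K : ι → ℂ) (χ₀ : Ω →ₜ* Circle) (q : ι → ℝ) (q₀ : ℝ)

/-- The exponent of the complex-rotated integrand:
`E(ζ, θ) = iζq₀ + ½ ∑ₐ (Kₐχₐ(θ) e^{iζqₐ} + conj(Kₐχₐ(θ)) e^{−iζqₐ})`; for real `ζ = τ` this is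
`iτq₀ + ∑ₐ Re(Kₐ χₐ(θ γ(τ)))`, for `ζ = i` its real part is `−q₀ + ∑ₐ Re(Kₐχₐ(θ)) cosh qₐ`.
[cite: FriedliVelenik2017, Thm 9.12, display (9.23)] -/
def charRotationExponent (ζ : ℂ) (θ : Ω) : ℂ :=
  I * (q₀ : ℂ) * ζ +
    (1 / 2 : ℂ) * ∑ a, (K a * ((χ a θ : Circle) : ℂ) * cexp (I * (q a : ℂ) * ζ) +
      conj (K a * ((χ a θ : Circle) : ℂ)) * cexp (-(I * (q a : ℂ) * ζ)))

/-- The `ζ`-derivative of the exponent. [folklore] -/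
def charRotationExponentDeriv (ζ : ℂ) (θ : Ω) : ℂ :=
  I * (q₀ : ℂ) +
    (1 / 2 : ℂ) * ∑ a, (K a * ((χ a θ : Circle) : ℂ) * (cexp (I * (q a : ℂ) * ζ) * (I * (q a : ℂ))) +
      conj (K a * ((χ a θ : Circle) : ℂ)) * (cexp (-(I * (q a : ℂ) * ζ)) * (-(I * (q a : ℂ)))))

/-- The complex-rotated integrand `χ₀(θ) · exp E(ζ, θ)`.
[cite: FriedliVelenik2017, Thm 9.12, display (9.23)] -/
def charRotationIntegrand (ζ : ℂ) (θ : Ω) : ℂ :=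
  ((χ₀ θ : Circle) : ℂ) * cexp (charRotationExponent χ K q q₀ ζ θ)

/-- The `ζ`-derivative of the rotated integrand. [folklore] -/
def charRotationIntegrandDeriv (ζ : ℂ) (θ : Ω) : ℂ :=
  ((χ₀ θ : Circle) : ℂ) *
    (cexp (charRotationExponent χ K q q₀ ζ θ) * charRotationExponentDeriv χ K q q₀ ζ θ)

/-! #### Continuity and differentiability in `ζ` -/

/-- The exponent is jointly continuous in `(ζ, θ)`. [folklore] -/
private theorem continuous_charRotationExponent :
    Continuous fun p : ℂ × Ω => charRotationExponent χ K q q₀ p.1 p.2 := by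
  unfold charRotationExponent
  have hw : ∀ a, Continuous fun p : ℂ × Ω => ((χ a p.2 : Circle) : ℂ) := fun a =>
    (continuous_coe_char (χ a)).comp continuous_snd
  fun_prop

/-- The derivative of the exponent is jointly continuous in `(ζ, θ)`. [folklore] -/
private theorem continuous_charRotationExponentDeriv :
    Continuous fun p : ℂ × Ω => charRotationExponentDeriv χ K q q₀ p.1 p.2 := by
  unfold charRotationExponentDeriv
  have hw : ∀ a, Continuous fun p : ℂ × Ω => ((χ a p.2 : Circle) : ℂ) := fun a =>
    (continuous_coe_char (χ a)).comp continuous_snd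
  fun_prop

/-- The rotated integrand is jointly continuous in `(ζ, θ)`. [folklore] -/
private theorem continuous_charRotationIntegrand :
    Continuous fun p : ℂ × Ω => charRotationIntegrand χ K χ₀ q q₀ p.1 p.2 := by
  unfold charRotationIntegrand
  have h₀ : Continuous fun p : ℂ × Ω => ((χ₀ p.2 : Circle) : ℂ) :=
    (continuous_coe_char χ₀).comp continuous_snd
  have hE := continuous_charRotationExponent χ K q q₀
  fun_prop

/-- The derivative of the rotated integrand is jointly continuous in `(ζ, θ)`. [folklore] -/
private theorem continuous_charRotationIntegrandDeriv :
    Continuous fun p : ℂ × Ω => charRotationIntegrandDeriv χ K χ₀ q q₀ p.1 p.2 := by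
  unfold charRotationIntegrandDeriv
  have h₀ : Continuous fun p : ℂ × Ω => ((χ₀ p.2 : Circle) : ℂ) :=
    (continuous_coe_char χ₀).comp continuous_snd
  have hE := continuous_charRotationExponent χ K q q₀
  have hE' := continuous_charRotationExponentDeriv χ K q q₀
  fun_prop

/-- `ζ ↦ c ζ` has derivative `c`. [folklore] -/
private theorem hasDerivAt_const_mul' (c ζ : ℂ) : HasDerivAt (fun z : ℂ => c * z) c ζ := by
  simpa using (hasDerivAt_id ζ).const_mul c

/-- The exponent is an entire function of `ζ` with the stated derivative. [folklore] -/
private theorem hasDerivAt_charRotationExponent (θ : Ω) (ζ : ℂ) :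
    HasDerivAt (fun z => charRotationExponent χ K q q₀ z θ)
      (charRotationExponentDeriv χ K q q₀ ζ θ) ζ := by
  unfold charRotationExponent charRotationExponentDeriv
  refine (hasDerivAt_const_mul' _ ζ).add (HasDerivAt.const_mul _ (HasDerivAt.fun_sum fun a _ => ?_))
  refine (HasDerivAt.const_mul _ ?_).add (HasDerivAt.const_mul _ ?_)
  · exact (hasDerivAt_const_mul' _ ζ).cexp
  · exact (hasDerivAt_const_mul' _ ζ).fun_neg.cexp

/-- The rotated integrand is an entire function of `ζ` with the stated derivative. [folklore] -/
private theorem hasDerivAt_charRotationIntegrand (θ : Ω) (ζ : ℂ) :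
    HasDerivAt (fun z => charRotationIntegrand χ K χ₀ q q₀ z θ)
      (charRotationIntegrandDeriv χ K χ₀ q q₀ ζ θ) ζ := by
  unfold charRotationIntegrand charRotationIntegrandDeriv
  exact ((hasDerivAt_charRotationExponent χ K q q₀ θ ζ).cexp).const_mul _

/-! #### Real rotations are translations of the group -/

/-- A character that is exponential along the rotation, read in `ℂ`:
`χ(γ τ) = e^{iτq}` gives `(χ(γ τ) : ℂ) = exp(i q τ)`. [cite: FriedliVelenik2017, Thm 9.12, proof (the rotation θⱼ ↦ θⱼ + i rⱼ)] -/
theorem coe_char_rotation {χ' : Ω →ₜ* Circle} {γ : ℝ → Ω} {r : ℝ}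
    (h : ∀ τ : ℝ, χ' (γ τ) = Circle.exp (τ * r)) (τ : ℝ) :
    ((χ' (γ τ) : Circle) : ℂ) = cexp (I * (r : ℂ) * (τ : ℂ)) := by
  rw [h τ, Circle.coe_exp]
  congr 1
  push_cast
  ring

variable {χ K χ₀ q q₀}

/-- For real `ζ = τ` the rotated integrand is the un-rotated integrand (`ζ = 0`) of the translated
configuration `θ · γ(τ)`, provided every character is exponential along the rotation `γ`.
[cite: FriedliVelenik2017, Thm 9.12, proof (periodicity of the integrand)] -/
theorem charRotationIntegrand_ofReal {γ : ℝ → Ω}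
    (hγ : ∀ a (τ : ℝ), χ a (γ τ) = Circle.exp (τ * q a))
    (hγ₀ : ∀ τ : ℝ, χ₀ (γ τ) = Circle.exp (τ * q₀)) (θ : Ω) (τ : ℝ) :
    charRotationIntegrand χ K χ₀ q q₀ (τ : ℂ) θ =
      charRotationIntegrand χ K χ₀ q q₀ 0 (θ * γ τ) := by
  have h0 : ((χ₀ (θ * γ τ) : Circle) : ℂ) = ((χ₀ θ : Circle) : ℂ) * cexp (I * (q₀ : ℂ) * (τ : ℂ)) := by
    rw [map_mul, Circle.coe_mul, coe_char_rotation hγ₀]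
  have ha : ∀ a, ((χ a (θ * γ τ) : Circle) : ℂ) =
      ((χ a θ : Circle) : ℂ) * cexp (I * (q a : ℂ) * (τ : ℂ)) := fun a => by
    rw [map_mul, Circle.coe_mul, coe_char_rotation (hγ a)]
  have hconj : ∀ a, conj (cexp (I * (q a : ℂ) * (τ : ℂ))) = cexp (-(I * (q a : ℂ) * (τ : ℂ))) := by
    intro a
    rw [← Complex.exp_conj, map_mul, map_mul, Complex.conj_I, Complex.conj_ofReal,
      Complex.conj_ofReal, neg_mul, neg_mul]
  have hE : charRotationExponent χ K q q₀ (τ : ℂ) θ =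
      I * (q₀ : ℂ) * (τ : ℂ) + charRotationExponent χ K q q₀ 0 (θ * γ τ) := by
    unfold charRotationExponent
    simp only [mul_zero, neg_zero, Complex.exp_zero, mul_one, zero_add, ha]
    congr 2
    refine Finset.sum_congr rfl fun a _ => ?_
    simp only [map_mul, hconj]
    ring
  rw [charRotationIntegrand, charRotationIntegrand, hE, Complex.exp_add, h0]
  ring

end Integrand

section Integrable

/-- A continuous function on a compact space with values in a second-countable normed group is
integrable for every finite measure (no second countability of the domain is needed).
[cite: FriedliVelenik2017, Thm 9.12, proof (finite-volume integrals)] -/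
theorem integrable_of_continuous_of_compactSpace {X E : Type*} [TopologicalSpace X]
    [CompactSpace X] [MeasurableSpace X] [OpensMeasurableSpace X] [NormedAddCommGroup E]
    [SecondCountableTopology E] (ν : Measure X) [IsFiniteMeasure ν] {g : X → E}
    (hg : Continuous g) : Integrable g ν := by
  obtain ⟨C, hC⟩ := isCompact_univ.exists_bound_of_continuousOn hg.continuousOn
  exact Integrable.of_bound hg.aestronglyMeasurable C (ae_of_all _ fun x => hC x (Set.mem_univ x))

end Integrable

/-! ### The rotated integral as an entire function of `ζ` -/

section Function

variable {Ω : Type*} [CommGroup Ω] [TopologicalSpace Ω] [IsTopologicalGroup Ω] [CompactSpace Ω]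
  [MeasurableSpace Ω] [BorelSpace Ω] (μ : Measure Ω) [IsFiniteMeasure μ]
  {ι : Type*} [Fintype ι]
  (χ : ι → Ω →ₜ* Circle) (K : ι → ℂ) (χ₀ : Ω →ₜ* Circle) (q : ι → ℝ) (q₀ : ℝ)

omit [IsTopologicalGroup Ω] in
/-- The weight is integrable. [cite: McBryanSpencer1977, proof of the main theorem (set-up)] -/
theorem integrable_complexGinibreWeight : Integrable (complexGinibreWeight χ K) μ :=
  integrable_of_continuous_of_compactSpace μ (continuous_complexGinibreWeight χ K)

omit [IsTopologicalGroup Ω] in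
/-- The partition function `∫ e^{∑ Re(Kₐχₐ)} dμ` is positive as soon as `μ ≠ 0`. [cite: McBryanSpencer1977, proof of the main theorem (set-up: Z > 0)] -/
theorem integral_complexGinibreWeight_pos [NeZero μ] :
    0 < ∫ θ, complexGinibreWeight χ K θ ∂μ := by
  have hle : ∫ _θ, Real.exp (-∑ a, ‖K a‖) ∂μ ≤ ∫ θ, complexGinibreWeight χ K θ ∂μ :=
    integral_mono (integrable_const _) (integrable_complexGinibreWeight μ χ K)
      fun θ => exp_neg_sum_norm_le_complexGinibreWeight χ K θ
  refine lt_of_lt_of_le ?_ hle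
  rw [integral_const, smul_eq_mul]
  exact mul_pos measureReal_univ_pos (Real.exp_pos _)

/-- The complex-rotated integral `Φ(ζ) = ∫ χ₀(θ) exp E(ζ, θ) dμ`.
[cite: FriedliVelenik2017, Thm 9.12, display (9.23)] -/
def charRotationFn (ζ : ℂ) : ℂ :=
  ∫ θ, charRotationIntegrand χ K χ₀ q q₀ ζ θ ∂μ

variable {χ K χ₀ q q₀}

omit [CompactSpace Ω] [IsFiniteMeasure μ] in
/-- **Invariance under real rotations**: for real `τ` the rotated integral equals the un-rotated
one (right-invariance of `μ` under `θ ↦ θ · γ(τ)`; in the angle picture: periodicity of the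
integrand). [cite: FriedliVelenik2017, Thm 9.12, proof (periodicity of the integrand)] -/
theorem charRotationFn_ofReal [μ.IsMulRightInvariant] {γ : ℝ → Ω}
    (hγ : ∀ a (τ : ℝ), χ a (γ τ) = Circle.exp (τ * q a))
    (hγ₀ : ∀ τ : ℝ, χ₀ (γ τ) = Circle.exp (τ * q₀)) (τ : ℝ) :
    charRotationFn μ χ K χ₀ q q₀ (τ : ℂ) = charRotationFn μ χ K χ₀ q q₀ 0 := by
  unfold charRotationFn
  simp_rw [charRotationIntegrand_ofReal (K := K) hγ hγ₀]
  exact integral_mul_right_eq_self (fun θ => charRotationIntegrand χ K χ₀ q q₀ 0 θ) (γ τ)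

variable (χ K χ₀ q q₀)

omit [IsTopologicalGroup Ω] in
/-- **Differentiation under the integral sign**: the rotated integral is complex-differentiable at
every `ζ₀`, with derivative the integral of the derivative of the integrand (dominated on the unit
ball around `ζ₀` by the maximum of the continuous derivative over the compact set
`closedBall ζ₀ 1 × Ω`). [folklore] -/
private theorem hasDerivAt_charRotationFn (ζ₀ : ℂ) :
    HasDerivAt (charRotationFn μ χ K χ₀ q q₀)
      (∫ θ, charRotationIntegrandDeriv χ K χ₀ q q₀ ζ₀ θ ∂μ) ζ₀ := by
  have hF := continuous_charRotationIntegrand χ K χ₀ q q₀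
  have hF' := continuous_charRotationIntegrandDeriv χ K χ₀ q q₀
  have hFζ : ∀ ζ, Continuous fun θ : Ω => charRotationIntegrand χ K χ₀ q q₀ ζ θ := fun ζ =>
    hF.comp (continuous_const.prodMk continuous_id)
  have hF'ζ : ∀ ζ, Continuous fun θ : Ω => charRotationIntegrandDeriv χ K χ₀ q q₀ ζ θ := fun ζ =>
    hF'.comp (continuous_const.prodMk continuous_id)
  obtain ⟨C, hC⟩ := ((isCompact_closedBall ζ₀ 1).prod isCompact_univ).exists_bound_of_continuousOn
    hF'.continuousOn
  have h := hasDerivAt_integral_of_dominated_loc_of_deriv_le (μ := μ)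
    (F := fun ζ θ => charRotationIntegrand χ K χ₀ q q₀ ζ θ)
    (F' := fun ζ θ => charRotationIntegrandDeriv χ K χ₀ q q₀ ζ θ) (x₀ := ζ₀)
    (s := Metric.ball ζ₀ 1) (bound := fun _ => C) (Metric.ball_mem_nhds ζ₀ one_pos)
    (Eventually.of_forall fun ζ => (hFζ ζ).aestronglyMeasurable)
    (integrable_of_continuous_of_compactSpace μ (hFζ ζ₀)) (hF'ζ ζ₀).aestronglyMeasurable
    (ae_of_all _ fun θ ζ hζ => hC (ζ, θ)
      (Set.mk_mem_prod (Metric.ball_subset_closedBall hζ) (Set.mem_univ θ)))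
    (integrable_const C)
    (ae_of_all _ fun θ ζ _ => hasDerivAt_charRotationIntegrand χ K χ₀ q q₀ θ ζ)
  exact h.2

omit [IsTopologicalGroup Ω] in
/-- The rotated integral is an entire function. [folklore] -/
private theorem differentiable_charRotationFn :
    Differentiable ℂ (charRotationFn μ χ K χ₀ q q₀) :=
  fun ζ => (hasDerivAt_charRotationFn μ χ K χ₀ q q₀ ζ).differentiableAt

variable {χ K χ₀ q q₀}

/-- **The complex rotation does not change the integral**: the entire function `charRotationFn`
is constant on the real axis, hence (identity theorem) constant on `ℂ`; in particular its value at
`ζ = i` equals its value at `ζ = 0` — the contour shift `θⱼ ↦ θⱼ + i aⱼ` of McBryan–Spencer /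
Friedli–Velenik Thm 9.12, for all variables simultaneously and for many-body characters.
[cite: McBryanSpencer1977, proof of the main theorem (complex rotation)] -/
theorem charRotationFn_I [μ.IsMulRightInvariant] {γ : ℝ → Ω}
    (hγ : ∀ a (τ : ℝ), χ a (γ τ) = Circle.exp (τ * q a))
    (hγ₀ : ∀ τ : ℝ, χ₀ (γ τ) = Circle.exp (τ * q₀)) :
    charRotationFn μ χ K χ₀ q q₀ I = charRotationFn μ χ K χ₀ q q₀ 0 := by
  have hana : AnalyticOnNhd ℂ (charRotationFn μ χ K χ₀ q q₀) Set.univ :=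
    (differentiable_charRotationFn μ χ K χ₀ q q₀).differentiableOn.analyticOnNhd isOpen_univ
  have hconst : AnalyticOnNhd ℂ (fun _ : ℂ => charRotationFn μ χ K χ₀ q q₀ 0) Set.univ :=
    analyticOnNhd_const
  have ht : Tendsto (fun n : ℕ => (((1 / ((n : ℝ) + 1) : ℝ)) : ℂ)) atTop (𝓝[≠] (0 : ℂ)) := by
    refine tendsto_nhdsWithin_iff.2 ⟨?_, Eventually.of_forall fun n => ?_⟩
    · have h0 : Tendsto (fun n : ℕ => (((1 / ((n : ℝ) + 1) : ℝ)) : ℂ)) atTop (𝓝 (((0 : ℝ)) : ℂ)) :=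
        (Complex.continuous_ofReal.tendsto (0 : ℝ)).comp tendsto_one_div_add_atTop_nhds_zero_nat
      rwa [Complex.ofReal_zero] at h0
    · rw [Set.mem_compl_iff, Set.mem_singleton_iff, ofReal_eq_zero]
      exact (by positivity : (0 : ℝ) < 1 / ((n : ℝ) + 1)).ne'
  have hfreq : ∃ᶠ z in 𝓝[≠] (0 : ℂ),
      charRotationFn μ χ K χ₀ q q₀ z = charRotationFn μ χ K χ₀ q q₀ 0 :=
    ht.frequently (Frequently.of_forall fun n => charRotationFn_ofReal μ hγ hγ₀ _)
  exact congrFun (hana.eq_of_frequently_eq hconst hfreq) I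

/-! ### The modulus at `ζ = i` and the value at `ζ = 0` -/

variable (χ K χ₀ q q₀)

/-- `I · c · I = −c`. [folklore] -/
private theorem I_mul_ofReal_mul_I' (c : ℝ) : I * (c : ℂ) * I = -(c : ℂ) := by
  rw [mul_right_comm, I_mul_I, neg_one_mul]

omit [TopologicalSpace Ω] [Fintype ι] in
/-- The real part of one rotated term at `ζ = i`: `Re(½ (w e^{−s} + w̄ e^{s})) = Re(w) cosh s`.
[cite: FriedliVelenik2017, Thm 9.12, display before (9.23)] -/
private theorem re_half_rotated_term (w : ℂ) (s : ℝ) :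
    ((1 / 2 : ℂ) * (w * cexp (I * (s : ℂ) * I) + conj w * cexp (-(I * (s : ℂ) * I)))).re =
      w.re * Real.cosh s := by
  rw [I_mul_ofReal_mul_I', neg_neg, ← Complex.ofReal_neg, ← Complex.ofReal_exp, ← Complex.ofReal_exp,
    Real.cosh_eq]
  simp only [Complex.mul_re, Complex.add_re, Complex.ofReal_re, Complex.ofReal_im, Complex.conj_re,
    Complex.conj_im, Complex.add_im, Complex.mul_im, mul_zero, sub_zero]
  norm_num
  ring

omit [IsTopologicalGroup Ω] [CompactSpace Ω] [MeasurableSpace Ω] [BorelSpace Ω] in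
/-- The real part of the exponent at `ζ = i`: `Re E(i, θ) = −q₀ + ∑ₐ Re(Kₐχₐ(θ)) cosh qₐ`.
[cite: FriedliVelenik2017, Thm 9.12, display before (9.23)] -/
theorem charRotationExponent_I_re (θ : Ω) :
    (charRotationExponent χ K q q₀ I θ).re =
      -q₀ + ∑ a, (K a * ((χ a θ : Circle) : ℂ)).re * Real.cosh (q a) := by
  unfold charRotationExponent
  rw [Complex.add_re, I_mul_ofReal_mul_I', Complex.neg_re, Complex.ofReal_re, Finset.mul_sum,
    Complex.re_sum]
  congr 1
  exact Finset.sum_congr rfl fun a _ => re_half_rotated_term _ _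

omit [IsTopologicalGroup Ω] [CompactSpace Ω] [MeasurableSpace Ω] [BorelSpace Ω] in
/-- The exponent at `ζ = 0` is the Hamiltonian `∑ₐ Re(Kₐχₐ(θ))` (the un-rotated weight). [folklore] -/
private theorem charRotationExponent_zero (θ : Ω) :
    charRotationExponent χ K q q₀ 0 θ = ((complexHamiltonian χ K θ : ℝ) : ℂ) := by
  unfold charRotationExponent complexHamiltonian
  simp only [mul_zero, neg_zero, Complex.exp_zero, mul_one, zero_add, Complex.add_conj]
  push_cast
  rw [Finset.mul_sum]
  refine Finset.sum_congr rfl fun a _ => ?_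
  ring

omit [IsTopologicalGroup Ω] [CompactSpace Ω] [MeasurableSpace Ω] [BorelSpace Ω] in
/-- The un-rotated integrand is `χ₀(θ)` times the Gibbs weight. [folklore] -/
private theorem charRotationIntegrand_zero (θ : Ω) :
    charRotationIntegrand χ K χ₀ q q₀ 0 θ =
      ((χ₀ θ : Circle) : ℂ) * ((complexGinibreWeight χ K θ : ℝ) : ℂ) := by
  rw [charRotationIntegrand, charRotationExponent_zero, complexGinibreWeight, Complex.ofReal_exp]

omit [IsTopologicalGroup Ω] [CompactSpace Ω] [MeasurableSpace Ω] [BorelSpace Ω] in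
/-- **The modulus of the rotated integrand** (Friedli–Velenik (9.23), last two steps: `cosh ≥ 1` and
`Re(Kχ) ≤ ‖K‖`):
`|χ₀(θ) exp E(i, θ)| ≤ e^{−q₀} · exp(∑ₐ ‖Kₐ‖ (cosh qₐ − 1)) · exp(∑ₐ Re(Kₐχₐ(θ)))`.
[cite: FriedliVelenik2017, Thm 9.12, display (9.23)] -/
theorem norm_charRotationIntegrand_I_le (θ : Ω) :
    ‖charRotationIntegrand χ K χ₀ q q₀ I θ‖ ≤
      Real.exp (-q₀) * Real.exp (∑ a, ‖K a‖ * (Real.cosh (q a) - 1)) *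
        complexGinibreWeight χ K θ := by
  rw [charRotationIntegrand, norm_mul, Circle.norm_coe, one_mul, Complex.norm_exp,
    charRotationExponent_I_re, complexGinibreWeight, ← Real.exp_add, ← Real.exp_add, Real.exp_le_exp,
    add_assoc, add_le_add_iff_left, complexHamiltonian, ← Finset.sum_add_distrib]
  refine Finset.sum_le_sum fun a _ => ?_
  have hre : (K a * ((χ a θ : Circle) : ℂ)).re ≤ ‖K a‖ := re_coupling_mul_char_le _ _ _
  have hcosh : 1 ≤ Real.cosh (q a) := Real.one_le_cosh _
  nlinarith [mul_nonneg (sub_nonneg.2 hre) (sub_nonneg.2 hcosh)]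

omit [IsTopologicalGroup Ω] [CompactSpace Ω] [BorelSpace Ω] [IsFiniteMeasure μ] in
/-- The un-rotated integral is `∫ χ₀ e^{∑ Re(Kₐχₐ)} dμ`. [folklore] -/
private theorem charRotationFn_zero :
    charRotationFn μ χ K χ₀ q q₀ 0 =
      ∫ θ, ((χ₀ θ : Circle) : ℂ) * ((complexGinibreWeight χ K θ : ℝ) : ℂ) ∂μ := by
  unfold charRotationFn
  exact integral_congr_ae (ae_of_all _ fun θ => charRotationIntegrand_zero χ K χ₀ q q₀ θ)

/-! ### The McBryan–Spencer a-priori bound -/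

variable {χ K χ₀ q q₀}

/-- **McBryan–Spencer complex-rotation bound, general abelian framework** (McBryan–Spencer 1977;
Friedli–Velenik 2017 Thm 9.12 (9.23); for gauge fields Glimm–Jaffe 1977): `Ω` a compact abelian
group with a finite right-invariant Borel measure `μ`, `χₐ, χ₀` continuous unitary characters, complex
couplings `Kₐ`, and a rotation `γ : ℝ → Ω` with `χₐ(γ τ) = e^{iτqₐ}`, `χ₀(γ τ) = e^{iτq₀}`. Then

  `‖∫ χ₀(θ) e^{∑ₐ Re(Kₐχₐ(θ))} dμ‖ ≤ e^{−q₀} · exp(∑ₐ ‖Kₐ‖ (cosh qₐ − 1)) · ∫ e^{∑ₐ Re(Kₐχₐ(θ))} dμ`.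

[cite: McBryanSpencer1977, proof of the main theorem (complex rotation bound)] -/
theorem norm_integral_char_mul_complexGinibreWeight_le [μ.IsMulRightInvariant] {γ : ℝ → Ω}
    (hγ : ∀ a (τ : ℝ), χ a (γ τ) = Circle.exp (τ * q a))
    (hγ₀ : ∀ τ : ℝ, χ₀ (γ τ) = Circle.exp (τ * q₀)) :
    ‖∫ θ, ((χ₀ θ : Circle) : ℂ) * ((complexGinibreWeight χ K θ : ℝ) : ℂ) ∂μ‖ ≤
      Real.exp (-q₀) * Real.exp (∑ a, ‖K a‖ * (Real.cosh (q a) - 1)) *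
        ∫ θ, complexGinibreWeight χ K θ ∂μ := by
  calc ‖∫ θ, ((χ₀ θ : Circle) : ℂ) * ((complexGinibreWeight χ K θ : ℝ) : ℂ) ∂μ‖
      = ‖charRotationFn μ χ K χ₀ q q₀ I‖ := by
        rw [charRotationFn_I μ hγ hγ₀, charRotationFn_zero]
    _ ≤ ∫ θ, ‖charRotationIntegrand χ K χ₀ q q₀ I θ‖ ∂μ := norm_integral_le_integral_norm _
    _ ≤ ∫ θ, Real.exp (-q₀) * Real.exp (∑ a, ‖K a‖ * (Real.cosh (q a) - 1)) *
          complexGinibreWeight χ K θ ∂μ :=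
        integral_mono_of_nonneg (ae_of_all _ fun _ => norm_nonneg _)
          ((integrable_complexGinibreWeight μ χ K).const_mul _)
          (ae_of_all _ fun θ => norm_charRotationIntegrand_I_le χ K χ₀ q q₀ θ)
    _ = Real.exp (-q₀) * Real.exp (∑ a, ‖K a‖ * (Real.cosh (q a) - 1)) *
          ∫ θ, complexGinibreWeight χ K θ ∂μ := integral_const_mul _ _

omit [IsTopologicalGroup Ω] in
/-- `∫ Re(c χ₀(θ)) w(θ) dμ = Re(c · ∫ χ₀ w dμ)`. [cite: McBryanSpencer1977, proof of the main theorem (real part of the rotated integral)] -/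
theorem integral_reMulChar_mul_complexGinibreWeight (c : ℂ) :
    ∫ θ, (c * ((χ₀ θ : Circle) : ℂ)).re * complexGinibreWeight χ K θ ∂μ =
      (c * ∫ θ, ((χ₀ θ : Circle) : ℂ) * ((complexGinibreWeight χ K θ : ℝ) : ℂ) ∂μ).re := by
  have hc : Continuous fun θ : Ω => ((χ₀ θ : Circle) : ℂ) * ((complexGinibreWeight χ K θ : ℝ) : ℂ) :=
    (continuous_coe_char χ₀).mul (Complex.continuous_ofReal.comp (continuous_complexGinibreWeight χ K))
  rw [← integral_const_mul, ← RCLike.re_to_complex, ← integral_re ((integrable_of_continuous_of_compactSpace μ hc).const_mul c)]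
  refine integral_congr_ae (ae_of_all _ fun θ => ?_)
  simp only [RCLike.re_to_complex, ← mul_assoc, Complex.re_mul_ofReal]

/-- **McBryan–Spencer bound for the observable `Re(c χ₀)`**: for every `c ∈ ℂ`,
`|∫ Re(c χ₀) e^{∑ Re(Kₐχₐ)} dμ| ≤ ‖c‖ e^{−q₀} exp(∑ₐ ‖Kₐ‖(cosh qₐ − 1)) ∫ e^{∑ Re(Kₐχₐ)} dμ`.
[cite: McBryanSpencer1977, proof of the main theorem (complex rotation bound)] -/
theorem abs_integral_reMulChar_mul_complexGinibreWeight_le [μ.IsMulRightInvariant] {γ : ℝ → Ω}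
    (hγ : ∀ a (τ : ℝ), χ a (γ τ) = Circle.exp (τ * q a))
    (hγ₀ : ∀ τ : ℝ, χ₀ (γ τ) = Circle.exp (τ * q₀)) (c : ℂ) :
    |∫ θ, (c * ((χ₀ θ : Circle) : ℂ)).re * complexGinibreWeight χ K θ ∂μ| ≤
      ‖c‖ * Real.exp (-q₀) * Real.exp (∑ a, ‖K a‖ * (Real.cosh (q a) - 1)) *
        ∫ θ, complexGinibreWeight χ K θ ∂μ := by
  rw [integral_reMulChar_mul_complexGinibreWeight]
  refine (Complex.abs_re_le_norm _).trans ?_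
  rw [norm_mul, mul_assoc ‖c‖, mul_assoc ‖c‖]
  exact mul_le_mul_of_nonneg_left (norm_integral_char_mul_complexGinibreWeight_le μ hγ hγ₀)
    (norm_nonneg c)

/-- **McBryan–Spencer bound, expectation form**: for every `c ∈ ℂ`,
`|⟨Re(c χ₀)⟩_K| ≤ ‖c‖ · e^{−q₀} · exp(∑ₐ ‖Kₐ‖ (cosh qₐ − 1))`
(for `μ = 0` the expectation is the junk value `0` and the bound is trivial).
[cite: McBryanSpencer1977, main theorem (a-priori bound before optimising the rotation)] -/
theorem abs_complexGinibreExpect_reMulChar_le [μ.IsMulRightInvariant] {γ : ℝ → Ω}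
    (hγ : ∀ a (τ : ℝ), χ a (γ τ) = Circle.exp (τ * q a))
    (hγ₀ : ∀ τ : ℝ, χ₀ (γ τ) = Circle.exp (τ * q₀)) (c : ℂ) :
    |complexGinibreExpect μ χ K (fun θ => (c * ((χ₀ θ : Circle) : ℂ)).re)| ≤
      ‖c‖ * Real.exp (-q₀) * Real.exp (∑ a, ‖K a‖ * (Real.cosh (q a) - 1)) := by
  have hR : 0 ≤ ‖c‖ * Real.exp (-q₀) * Real.exp (∑ a, ‖K a‖ * (Real.cosh (q a) - 1)) := by
    positivity
  by_cases hμ : μ = 0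
  · subst hμ
    simp only [complexGinibreExpect, integral_zero_measure, div_zero, abs_zero]
    exact hR
  · haveI : NeZero μ := ⟨hμ⟩
    have hZ := integral_complexGinibreWeight_pos μ χ K
    rw [complexGinibreExpect, abs_div, abs_of_pos hZ, div_le_iff₀ hZ]
    exact abs_integral_reMulChar_mul_complexGinibreWeight_le μ hγ hγ₀ c

end Function

/-! ### The torus `U(1)^S`: rotations by real fields and the coordinate characters -/

section Torus

variable {S : Type*}

/-- The rotation of the torus `U(1)^S` by the real field `a`: `(e^{iτ aₛ})ₛ`.
[cite: FriedliVelenik2017, Thm 9.12, proof (the shift `θⱼ ↦ θⱼ + i rⱼ`)] -/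
def expField (a : S → ℝ) (τ : ℝ) : S → Circle := fun s => Circle.exp (τ * a s)

/-- `expField a τ s = e^{iτ aₛ}`. [cite: FriedliVelenik2017, Thm 9.12, proof (the rotation θⱼ ↦ θⱼ + i rⱼ)] -/
@[simp] theorem expField_apply (a : S → ℝ) (τ : ℝ) (s : S) : expField a τ s = Circle.exp (τ * a s) := rfl

/-- `Circle.exp` turns finite sums into products. [cite: FriedliVelenik2017, Thm 9.12, proof (the rotation θⱼ ↦ θⱼ + i rⱼ)] -/
theorem Circle.exp_finset_sum {α : Type*} (t : Finset α) (f : α → ℝ) :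
    Circle.exp (∑ s ∈ t, f s) = ∏ s ∈ t, Circle.exp (f s) := by
  classical
  induction t using Finset.induction_on with
  | empty => simp
  | insert a t ha ih => rw [Finset.sum_insert ha, Finset.prod_insert ha, Circle.exp_add, ih]

/-- The coordinate character `θ ↦ θₛ` of the torus `U(1)^S` (Ginibre's one-spin character).
[cite: Ginibre1970, main theorem with the plane-rotator example cos(m·φ)] -/
def coordChar (s : S) : (S → Circle) →ₜ* Circle where
  toFun θ := θ s
  map_one' := rfl
  map_mul' _ _ := rfl
  continuous_toFun := continuous_apply s

/-- `coordChar s θ = θ s`. [cite: Ginibre1970, main theorem with the plane-rotator example cos(m·φ)] -/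
@[simp] theorem coordChar_apply (s : S) (θ : S → Circle) : coordChar s θ = θ s := rfl

/-- Along the rotation by the field `a` the coordinate character is the exponential `e^{iτ aₛ}`.
[cite: FriedliVelenik2017, Thm 9.12, proof (the rotation θⱼ ↦ θⱼ + i rⱼ)] -/
theorem coordChar_expField (a : S → ℝ) (s : S) (τ : ℝ) :
    coordChar s (expField a τ) = Circle.exp (τ * a s) := rfl

variable [Fintype S]

/-- The monomial character `θ ↦ ∏ₛ θₛ^{mₛ}` (`m : S → ℤ`; Ginibre's `cos(m·φ)` is its real part).
[cite: Ginibre1970, main theorem with the plane-rotator example cos(m·φ)] -/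
def monomialChar (m : S → ℤ) : (S → Circle) →ₜ* Circle where
  toFun θ := ∏ s, θ s ^ m s
  map_one' := by simp
  map_mul' θ θ' := by
    rw [← Finset.prod_mul_distrib]
    exact Finset.prod_congr rfl fun s _ => mul_zpow _ _ _
  continuous_toFun := continuous_finsetProd _ fun s _ => (continuous_apply s).zpow (m s)

/-- `monomialChar m θ = ∏ₛ θₛ^{mₛ}`. [cite: Ginibre1970, main theorem with the plane-rotator example cos(m·φ)] -/
theorem monomialChar_apply (m : S → ℤ) (θ : S → Circle) : monomialChar m θ = ∏ s, θ s ^ m s := rfl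

/-- Along the rotation by the field `a` the monomial character `∏ θₛ^{mₛ}` is the exponential
`e^{iτ ⟨a, m⟩}`, `⟨a, m⟩ = ∑ₛ mₛ aₛ`. [cite: FriedliVelenik2017, Thm 9.12, proof (the rotation θⱼ ↦ θⱼ + i rⱼ)] -/
theorem monomialChar_expField (a : S → ℝ) (m : S → ℤ) (τ : ℝ) :
    monomialChar m (expField a τ) = Circle.exp (τ * ∑ s, (m s : ℝ) * a s) := by
  rw [monomialChar_apply, Finset.mul_sum, Circle.exp_finset_sum]
  refine Finset.prod_congr rfl fun s _ => ?_
  rw [expField_apply, ← Circle.exp_intCast_mul]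
  congr 1
  ring

end Torus

end Literature.Probability.LatticeModels

end
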